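import Literature.AlgebraicGeometry.Motives.ProjectiveSpaceHyperplaneMultiplicity
import Literature.AlgebraicGeometry.Motives.CompleteIntersectionLinesThroughPoints
import Literature.AlgebraicGeometry.Motives.LinearSubspacesGenerateChowProofs
import HarnessLib

/-!
# `CH₀` of a variety swept out by lines is supported on a hyperplane section (Voisin II, remark after Prop. 10.26)

On the tree's cycle carriers (`Motives/Cycles`: `primeCycle`, `cyclesOfDim`, `ratTrivial`,
`IsRationallyEquivalent`; Fulton's `D · [V]` as a cycle, `CartierDivisor.primeInter` of
`Motives/CartierDivisorIntersectionCycle`; hypersurfaces `V₊(F)` of `ℙᴺ` as effective Cartier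
divisors, `ProjSpace.formDivisor` of `Motives/ProjectiveSpaceFormDivisors`; line points
`IsLinePoint N i z` of `Motives/LinesGenerateChowOne`), PROVED:

* `exists_forall_isRationallyEquivalent_primeCycle_of_sum_degree_succ_le` — **for `K`
  algebraically closed and a closed immersion `i : X ↪ ℙᴺ_K` of an integral `K`-scheme locally of
  finite type with image `V₊(F₁, …, F_r)`, `deg Fⱼ = dⱼ ≥ 1`, `Σⱼ dⱼ + 1 ≤ N`, there is a proper
  Zariski-closed `W ⊊ X` (a coordinate hyperplane section `X ∩ V₊(x_m)`) such that every closed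
  point `x` of `X` is rationally equivalent ON `X` to a `0`-cycle supported on `W`.**

This is the remark following Prop. 10.26 in C. Voisin, *Hodge Theory and Complex Algebraic
Geometry II* (§10.2.3): "if `X` is covered by rational curves […] all the points `y ∈ C_x` are
rationally equivalent in `C_x`, so also in `X`, and […] `x` is rationally equivalent in `X` to any
point of `X' ∩ C_x`", for the LINES `C_x` supplied by Esnault–Levine–Viehweg, Lemma 4.2 a)
(`EsnaultLevineViehweg.exists_isLinePoint_of_isClosed`, `Motives/CompleteIntersectionLinesThroughPoints`:
a line of `X` through every closed point when `Σⱼ dⱼ + 1 ≤ N`). For a smooth cubic fourfold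
`X ⊂ ℙ⁵_ℂ` (`3 + 1 ≤ 5`) it is the `CH₀`-hypothesis of the Bloch–Srinivas / Conte–Murre route to
the Hodge conjecture for cubic fourfolds (`HodgeTheory.hodgeTwoTwo_algebraic_cubicFourfold_of_forall_point`,
`HodgeTheory/CubicFourfoldHodgeConjectureProofs`; Murre 1977, p. 230: cubic fourfolds are covered
by lines).

Proof: given a closed point `x ∉ W` (`x_m` a coordinate with `V₊(x_m) ⊅ X`) and a line
`Λ = closure {z} ∋ x` of `X`, choose a linear form `ℓ₁` vanishing at `x` but not along `Λ`
(`exists_linearForm_aeval_eq_zero_notMem_span`: rank–nullity on `K[x]₁`; closed points are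
`K`-rational, `EsnaultLevineViehweg.exists_algPoints_pt_eq`). The restrictions `i^*V₊(x_m) ∼ i^*V₊(ℓ₁)`
are linearly equivalent Cartier divisors on `X`, so `i^*V₊(x_m) · [Λ] - i^*V₊(ℓ₁) · [Λ] ∈ Rat₀(X)`
(Fulton, Def. 2.3 / Cor. 2.4.1 on `X`: `CartierDivisor.LinEquiv.interCycle_sub_interCycle_mem`,
`Motives/CartierDivisorIntersectionRat`). Now `i^*V₊(ℓ₁) · [Λ] = [x]` EXACTLY: pushed along `i`
(Fulton, Prop. 2.3 (c), `CartierDivisor.map_primeInter_pullbackAvoiding`) it is `V₊(ℓ₁) · [i(Λ)]`,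
which is the prime cycle of a point of `i(Λ) ∩ V₊(ℓ₁) = {i x}` with multiplicity ONE (Fulton,
Example 2.5.1: `ProjSpace.exists_primeInter_formDivisor_eq_primeCycle_of_isLinearSubspacePoint`,
`Motives/ProjectiveSpaceHyperplaneMultiplicity`). And `i^*V₊(x_m) · [Λ]` is supported on `W`.

Also: `closure_singleton_eq_of_height_eq_zero`, `isClosed_singleton_of_height_eq_zero` (points of
dimension `0` of a scheme are closed), `mem_span_of_mem_ideal_span_of_mem_grading_one` (a linear
form in the ideal of linear forms is in their `K`-span). Everything is proved; no named facts, no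
definitions.

## References

* C. Voisin, *Hodge Theory and Complex Algebraic Geometry II*, CUP (2003): Prop. 10.26 and the
  remark following it (§10.2.3, p. 305 f.). [VoisinHodgeII2003]
* W. Fulton, *Intersection Theory*, 2nd ed., Springer (1998): Example 2.5.1 (p. 41), Def. 2.3
  (p. 33), Prop. 2.3 (c) (p. 34), Cor. 2.4.1 (p. 37). [Fulton1998]
* H. Esnault, M. Levine, E. Viehweg, *Chow groups of projective varieties of very small degree*,
  Duke Math. J. 87 (1997) 29–58: Lemma 4.2 a). [EsnaultLevineViehweg1997]
* J. P. Murre, *On the Hodge conjecture for unirational fourfolds*, Indag. Math. 80 (1977)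
  230–232, p. 230. [Murre1977]
-/

noncomputable section

universe u

open CategoryTheory AlgebraicGeometry Order Topology TopologicalSpace IsLocalRing HomogeneousLocalization
open MvPolynomial (X C)
open Literature.AlgebraicGeometry.Motives.Segre Literature.AlgebraicGeometry.Motives.RatFn

-- No `attribute [local instance] MvPolynomial.gradedAlgebra`: statements and proofs needing the
-- grading of `K[x₀, …, x_N]` supply it by an inline `letI`, which elaborates to the same terms as in
-- the files defining `ProjSpace.formDivisor`, `IsLinearSubspacePoint`, … (pattern of
-- `Motives/CompleteIntersectionLinesThroughPoints`).

namespace Literature.AlgebraicGeometry.Motives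

/-! ### Linear forms in an ideal generated by linear forms -/

section LinearForms

variable {K : Type u} [Field K] {d : ℕ}

/-- **A linear form in the ideal of the linear forms `M_j` is a `K`-linear combination of them**
(degree-one case of `exists_eq_sum_mul_of_mem_span_of_isHomogeneous`,
`Motives/ProjectiveSpaceHyperplaneMultiplicity`: the coefficients are forms of degree `0`, i.e.
constants). [folklore] -/
theorem mem_span_of_mem_ideal_span_of_mem_grading_one {t : ℕ}
    {M : Fin t → MvPolynomial (Fin (d + 1)) K} (hM : ∀ j, M j ∈ grading (Fin (d + 1)) K 1)
    {ℓ : MvPolynomial (Fin (d + 1)) K} (hℓ : ℓ ∈ grading (Fin (d + 1)) K 1)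
    (hℓM : ℓ ∈ Ideal.span (Set.range M)) : ℓ ∈ Submodule.span K (Set.range M) := by
  obtain ⟨G, hG, rfl⟩ := exists_eq_sum_mul_of_mem_span_of_isHomogeneous M
    (fun j => (MvPolynomial.mem_homogeneousSubmodule 1 (M j)).1 (hM j)) hℓM le_rfl
    ((MvPolynomial.mem_homogeneousSubmodule 1 _).1 hℓ)
  refine Submodule.sum_mem _ fun j _ => ?_
  -- `G j` is a constant
  have hGj : G j = C (MvPolynomial.coeff 0 (G j)) :=
    MvPolynomial.totalDegree_eq_zero_iff_eq_C.mp
      ((MvPolynomial.totalDegree_zero_iff_isHomogeneous _).mpr (hG j))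
  rw [hGj, MvPolynomial.C_mul']
  exact Submodule.smul_mem _ _ (Submodule.subset_span ⟨j, rfl⟩)

end LinearForms


/-! ### Closed points: dimension zero -/

section ClosedPoints

/-- **A point of dimension `0` of a scheme is a closed point**: `closure {x} = {x}` when
`Order.height x = 0` in the specialisation order (a specialisation `x ⤳ y` is `y ≤ x`, and `x` is
minimal; schemes are `T₀`). [folklore] -/
theorem closure_singleton_eq_of_height_eq_zero {Y : Scheme.{u}} {x : Y} (hx : height x = 0) :
    closure ({x} : Set Y) = {x} := by
  refine Set.Subset.antisymm (fun y hy => ?_) subset_closure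
  have hxy : x ⤳ y := specializes_iff_mem_closure.2 hy
  have hle : y ≤ x := Scheme.le_iff_specializes.2 hxy
  have hmin : IsMin x := Order.height_eq_zero.1 hx
  have hyx : y ⤳ x := Scheme.le_iff_specializes.1 (hmin hle)
  exact (hyx.antisymm hxy).eq

/-- A point of dimension `0` of a scheme is closed. [folklore] -/
theorem isClosed_singleton_of_height_eq_zero {Y : Scheme.{u}} {x : Y} (hx : height x = 0) :
    IsClosed ({x} : Set Y) := by
  rw [← closure_singleton_eq_of_height_eq_zero hx]
  exact isClosed_closure

end ClosedPoints

/-! ### A linear form through a point, off a given pencil -/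

section LinearAlgebra

variable {K : Type u} [Field K] {N : ℕ}

/-- **A hyperplane through a point not containing a given linear subspace of small codimension.**
For a nonzero vector `p ∈ Kᴺ⁺¹` and fewer than `N` linear forms `L₁, …, L_t` (`t < N`), there is a
nonzero linear form `ℓ` vanishing at `p` which is not a `K`-linear combination of the `L_j`: the
linear forms vanishing at `p` form a hyperplane (dimension `N`) of `K[x]₁ ≅ Kᴺ⁺¹`, which cannot
lie in the span of `t < N` vectors (rank–nullity). [folklore] -/
theorem exists_linearForm_aeval_eq_zero_notMem_span {t : ℕ} (htN : t < N) {p : Fin (N + 1) → K}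
    (hp : p ≠ 0) (L : Fin t → MvPolynomial (Fin (N + 1)) K)
    (hL : ∀ j, L j ∈ grading (Fin (N + 1)) K 1) :
    ∃ ℓ : MvPolynomial (Fin (N + 1)) K, ℓ ∈ grading (Fin (N + 1)) K 1 ∧ ℓ ≠ 0 ∧
      MvPolynomial.aeval p ℓ = 0 ∧ ℓ ∉ Submodule.span K (Set.range L) := by
  classical
  set V₁ : Submodule K (MvPolynomial (Fin (N + 1)) K) := grading (Fin (N + 1)) K 1 with hV₁
  haveI : FiniteDimensional K V₁ :=
    Module.Finite.iff_fg.2 (MvPolynomial.homogeneousSubmodule_fg (Fin (N + 1)) K 1)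
  have hV₁rank : Module.finrank K V₁ = N + 1 := by
    rw [hV₁, ProjSpace.finrank_homogeneousSubmodule, add_comm 1 N, Nat.choose_succ_self_right]
  -- evaluation at `p` on linear forms
  set ψ : V₁ →ₗ[K] K := (MvPolynomial.aeval p).toLinearMap.comp V₁.subtype with hψ
  have hψ_apply : ∀ f : V₁, ψ f = MvPolynomial.aeval p (f : MvPolynomial (Fin (N + 1)) K) :=
    fun f => rfl
  -- `ψ ≠ 0`: some coordinate of `p` is nonzero
  obtain ⟨a, ha⟩ : ∃ a, p a ≠ 0 := by
    by_contra h
    push Not at h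
    exact hp (funext h)
  have hψne : ψ ≠ 0 := by
    intro h0
    have h1 : ψ ⟨X a, X_mem K a⟩ = 0 := by rw [h0, LinearMap.zero_apply]
    rw [hψ_apply] at h1
    simp only [MvPolynomial.aeval_X] at h1
    exact ha h1
  -- `dim ker ψ = N`
  have hker : Module.finrank K (LinearMap.ker ψ) = N := by
    have hrn := LinearMap.finrank_range_add_finrank_ker ψ
    have hr1 : Module.finrank K (LinearMap.range ψ) ≤ 1 :=
      (Submodule.finrank_le _).trans (Module.finrank_self K).le
    have hr0 : Module.finrank K (LinearMap.range ψ) ≠ 0 := by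
      rw [Ne, Submodule.finrank_eq_zero, LinearMap.range_eq_bot]
      exact hψne
    omega
  -- the span of the `L_j` inside `V₁` has dimension `≤ t < N`
  set L₁ : Fin t → V₁ := fun j => ⟨L j, hL j⟩ with hL₁
  set T : Submodule K V₁ := Submodule.span K (Set.range L₁) with hT
  have hTrank : Module.finrank K T ≤ t := by
    refine (finrank_span_le_card (Set.range L₁)).trans ?_
    rw [Set.toFinset_range]
    exact (Finset.card_image_le).trans (by simp)
  -- so `ker ψ ⊄ T`
  have hnot : ¬ LinearMap.ker ψ ≤ T := fun hle => by
    have := Submodule.finrank_mono hle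
    omega
  obtain ⟨f, hfker, hfT⟩ := SetLike.not_le_iff_exists.1 hnot
  refine ⟨f, f.2, ?_, ?_, ?_⟩
  · intro hf0
    apply hfT
    have : f = 0 := Subtype.ext hf0
    rw [this]
    exact zero_mem T
  · rw [← hψ_apply]
    exact hfker
  · intro hfspan
    apply hfT
    -- `range L = V₁.subtype '' range L₁`
    have hrange : Set.range L = V₁.subtype '' Set.range L₁ := by
      ext g
      constructor
      · rintro ⟨j, rfl⟩
        exact ⟨L₁ j, ⟨j, rfl⟩, rfl⟩
      · rintro ⟨_, ⟨j, rfl⟩, rfl⟩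
        exact ⟨j, rfl⟩
    rw [hrange, ← Submodule.map_span] at hfspan
    obtain ⟨g, hg, hgf⟩ := Submodule.mem_map.1 hfspan
    have : g = f := Subtype.ext hgf
    rwa [this] at hg

end LinearAlgebra

/-! ### `CH₀` of a variety covered by lines is supported on a hyperplane section -/

section ChowZero

variable {K : Type u} [Field K] [IsAlgClosed K] {N : ℕ} {X : SchemeOver K}
  [IsIntegral X.left] [LocallyOfFiniteType X.hom]

/-- **`CH₀` of a variety swept out by lines is supported on a hyperplane section, point by point.**
Let `K` be algebraically closed and `i : X ↪ ℙᴺ_K` a closed immersion of an integral `K`-scheme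
locally of finite type whose image is `V₊(F₁, …, F_r)` for forms of positive degrees `dⱼ` with
`Σⱼ dⱼ + 1 ≤ N` (e.g. a smooth cubic fourfold in `ℙ⁵`: `3 + 1 ≤ 5`). Then there is a proper
Zariski-closed `W ⊊ X` — the hyperplane section `X ∩ V₊(x_m)` by a coordinate hyperplane not
containing `X` — such that every closed point `x` of `X` is rationally equivalent ON `X` to a
`0`-cycle supported on `W`. Proof (Voisin's remark after Prop. 10.26 of *Hodge Theory II*, made
explicit): through `x` passes a line `Λ = closure {z}` of `X` (Esnault–Levine–Viehweg, Lemma 4.2 a),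
`EsnaultLevineViehweg.exists_isLinePoint_of_isClosed`); if `x ∉ W`, choose a linear form `ℓ₁`
vanishing at `x` but not along `Λ` (`exists_linearForm_aeval_eq_zero_notMem_span`); the restricted
hyperplanes `i^*V₊(x_m) ∼ i^*V₊(ℓ₁)` are linearly equivalent, so
`i^*V₊(x_m) · [Λ] - i^*V₊(ℓ₁) · [Λ] ∈ Rat₀(X)` (Fulton, Def. 2.3 / Cor. 2.4.1 on `X`:
`CartierDivisor.LinEquiv.interCycle_sub_interCycle_mem`); and `i^*V₊(ℓ₁) · [Λ] = [x]` exactly,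
because in `ℙᴺ` a hyperplane meets a line not contained in it in one point with multiplicity one
(`ProjSpace.exists_primeInter_formDivisor_eq_primeCycle_of_isLinearSubspacePoint`, Fulton
Example 2.5.1; `CartierDivisor.map_primeInter_pullbackAvoiding`, Prop. 2.3 (c)), while
`i^*V₊(x_m) · [Λ]` is supported on `W`. [cite: VoisinHodgeII2003, remark following Prop. 10.26 (§10.2.3)]
[cite: Fulton1998, Example 2.5.1, Def. 2.3 and Prop. 2.3 (c)]
[cite: EsnaultLevineViehweg1997, Lemma 4.2 a) (l = 1)] -/
theorem exists_forall_isRationallyEquivalent_primeCycle_of_sum_degree_succ_le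
    (i : X ⟶ projectiveSpace N K) [IsClosedImmersion i.left] {ι : Type*} [Fintype ι]
    (F : ι → MvPolynomial (Fin (N + 1)) K) (d : ι → ℕ) (hF : ∀ j, (F j).IsHomogeneous (d j))
    (hd : ∀ j, 0 < d j) (hsum : ∑ j, d j + 1 ≤ N)
    (hV : letI := MvPolynomial.gradedAlgebra (σ := Fin (N + 1)) (R := K)
      Set.range i.left.base =
        ProjectiveSpectrum.zeroLocus (MvPolynomial.homogeneousSubmodule (Fin (N + 1)) K)
          (Set.range F)) :
    ∃ W : Set ↥X.left, IsClosed W ∧ W ≠ Set.univ ∧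
      ∀ x : ↥X.left, height x = 0 →
        ∃ c' ∈ cyclesOfDim X.left 0, (∀ z, c' z ≠ 0 → z ∈ W) ∧
          IsRationallyEquivalent (primeCycle x) c' 0 := by
  classical
  letI := MvPolynomial.gradedAlgebra (σ := Fin (N + 1)) (R := K)
  haveI : CompactSpace ↥X.left := i.left.isClosedEmbedding.compactSpace
  -- a coordinate hyperplane `V₊(x_m) ⊅ i(X)` and the hyperplane section `W = X ∩ V₊(x_m)`
  obtain ⟨m, hm⟩ := ProjSpace.exists_X_notMem (d := N) (K := K) (i.left (genericPoint ↥X.left))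
  set W : Set ↥X.left := {x | (MvPolynomial.X m : MvPolynomial (Fin (N + 1)) K) ∈
    ProjectiveSpectrum.asHomogeneousIdeal (𝒜 := MvPolynomial.homogeneousSubmodule (Fin (N + 1)) K)
      (i.left.base x)} with hW_def
  have hWpre : W = i.left.base ⁻¹'
      ProjectiveSpectrum.zeroLocus (MvPolynomial.homogeneousSubmodule (Fin (N + 1)) K) {MvPolynomial.X m} := by
    ext x
    change (MvPolynomial.X m : MvPolynomial (Fin (N + 1)) K) ∈
        ProjectiveSpectrum.asHomogeneousIdeal
          (𝒜 := MvPolynomial.homogeneousSubmodule (Fin (N + 1)) K) (i.left.base x) ↔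
      ({MvPolynomial.X m} : Set (MvPolynomial (Fin (N + 1)) K)) ⊆
        (ProjectiveSpectrum.asHomogeneousIdeal
          (𝒜 := MvPolynomial.homogeneousSubmodule (Fin (N + 1)) K) (i.left.base x) :
            Set (MvPolynomial (Fin (N + 1)) K))
    exact Set.singleton_subset_iff.symm
  refine ⟨W, ?_, ?_, fun x hx0 => ?_⟩
  · rw [hWpre]
    exact (ProjectiveSpectrum.isClosed_zeroLocus _ _).preimage i.left.continuous
  · intro hWu
    have h : genericPoint ↥X.left ∈ W := hWu ▸ Set.mem_univ _
    exact hm h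
  -- a line `closure {z}` of `X` through the closed point `x`
  have hxcl : IsClosed ({x} : Set ↥X.left) := isClosed_singleton_of_height_eq_zero hx0
  obtain ⟨z, hz, hxz⟩ :=
    EsnaultLevineViehweg.exists_isLinePoint_of_isClosed i F d hF hd hsum hV hxcl
  by_cases hxW : x ∈ W
  · -- `x` already lies on the hyperplane section
    refine ⟨primeCycle x, primeCycle_mem_cyclesOfDim (by exact_mod_cast hx0), fun z' hz' => ?_,
      IsRationallyEquivalent.refl _⟩
    by_cases h : z' = x
    · rw [h]; exact hxW
    · exact absurd (primeCycle_apply_of_ne h) hz'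
  · set ix := i.left.base x with hix_def
    set iz := i.left.base z with hiz_def
    have hzx : z ⤳ x := specializes_iff_mem_closure.2 hxz
    have hizx : iz ⤳ ix := i.left.base.hom.map_specializes hzx
    have hN : 1 ≤ N := by omega
    -- `iz` is a line point of `ℙᴺ`; its prime is `(L₁, …, L_{N-1})`
    have hw : IsLinearSubspacePoint 1 N (𝟙 (projectiveSpace N K)) iz :=
      ((isLinePoint_iff_isLinearSubspacePoint_one z).1 hz).base_of_isClosedImmersion
    obtain ⟨L, hL, hhom, hcl, hspan, -⟩ := hw.exists_eq_span_of_id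
    have hLmem : ∀ j, L j ∈ grading (Fin (N + 1)) K 1 := fun j =>
      (MvPolynomial.mem_homogeneousSubmodule 1 (L j)).2 (hhom j)
    -- homogeneous coordinates `p` of `x`
    obtain ⟨Pt, hPx⟩ := EsnaultLevineViehweg.exists_algPoints_pt_eq (X := X) hxcl
    obtain ⟨p, hp, hQ⟩ := ProjectiveSpace.exists_eq_pointOfVec (AlgPoints.map i Pt)
    have hixp : ix = (ProjectiveSpace.pointOfVec K p hp).pt := by
      rw [hix_def, ← hPx, ← AlgPoints.pt_map, hQ]
    -- a linear form `ℓ₁` through `x`, off the line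
    obtain ⟨ℓ₁, hℓ₁, hℓ₁0, hℓ₁p, hℓ₁span⟩ :=
      exists_linearForm_aeval_eq_zero_notMem_span (t := N - 1) (by omega) hp L hLmem
    have hℓ₁x : ℓ₁ ∈ ProjectiveSpectrum.asHomogeneousIdeal
        (𝒜 := MvPolynomial.homogeneousSubmodule (Fin (N + 1)) K) ix := by
      have h := (ProjectiveSpace.pt_pointOfVec_mem_zeroLocus_iff p hp zero_lt_one hℓ₁).2 hℓ₁p
      rw [← hixp] at h
      exact Set.singleton_subset_iff.1 ((ProjectiveSpectrum.mem_zeroLocus _ _ _).1 h)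
    have hℓ₁z : ℓ₁ ∉ ProjectiveSpectrum.asHomogeneousIdeal
        (𝒜 := MvPolynomial.homogeneousSubmodule (Fin (N + 1)) K) iz := by
      intro h
      apply hℓ₁span
      refine mem_span_of_mem_ideal_span_of_mem_grading_one hLmem hℓ₁ ?_
      rw [← hspan]
      exact h
    -- on `ℙᴺ`: `V₊(ℓ₁) · [line] = [w']` for a `0`-plane point `w'` (Fulton, Example 2.5.1)
    obtain ⟨w', hw'0, hprime⟩ :=
      ProjSpace.exists_primeInter_formDivisor_eq_primeCycle_of_isLinearSubspacePoint le_rfl hw hℓ₁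
        hℓ₁0 hℓ₁z
    -- `w' = ix`: both are THE point of `closure {iz} ∩ V₊(ℓ₁) = V₊(L, ℓ₁)`
    have hw'x : w' = ix := by
      -- the point `w''` of `V₊(L, ℓ₁)`, a closed point
      set L' : Fin (N - 1 + 1) → MvPolynomial (Fin (N + 1)) K := Fin.snoc L ℓ₁ with hL'
      have hL'ind : LinearIndependent K L' := linearIndependent_finSnoc.2 ⟨hL, hℓ₁span⟩
      have hL'hom : ∀ j, (L' j).IsHomogeneous 1 := by
        intro j
        refine Fin.lastCases ?_ (fun i => ?_) j
        · rw [hL', Fin.snoc_last]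
          exact (MvPolynomial.mem_homogeneousSubmodule 1 ℓ₁).1 hℓ₁
        · rw [hL', Fin.snoc_castSucc]
          exact hhom i
      obtain ⟨w'', hw''span, hhtw'', -⟩ := exists_point_of_linearIndependent L' hL'ind hL'hom (by omega)
      have hht0 : height w'' = 0 := by
        rw [hhtw'']
        have : N - (N - 1 + 1) = 0 := by omega
        rw [this]
        rfl
      -- every point of `closure {iz} ∩ V₊(ℓ₁)` is `w''`
      have key : ∀ q : ↥(projectiveSpace N K).left, iz ⤳ q →
          ℓ₁ ∈ ProjectiveSpectrum.asHomogeneousIdeal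
            (𝒜 := MvPolynomial.homogeneousSubmodule (Fin (N + 1)) K) q → q = w'' := by
        intro q hzq hℓq
        have hqL : Set.range L ⊆ (ProjectiveSpectrum.asHomogeneousIdeal
            (𝒜 := MvPolynomial.homogeneousSubmodule (Fin (N + 1)) K) q :
              Set (MvPolynomial (Fin (N + 1)) K)) := by
          have hmem : q ∈ closure {iz} := hzq.mem_closure
          rw [hcl] at hmem
          exact (ProjectiveSpectrum.mem_zeroLocus _ _ _).1 hmem
        have hqL' : Set.range L' ⊆ (ProjectiveSpectrum.asHomogeneousIdeal
            (𝒜 := MvPolynomial.homogeneousSubmodule (Fin (N + 1)) K) q :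
              Set (MvPolynomial (Fin (N + 1)) K)) := by
          rintro _ ⟨j, rfl⟩
          refine Fin.lastCases ?_ (fun i => ?_) j
          · rw [hL', Fin.snoc_last]
            exact hℓq
          · rw [hL', Fin.snoc_castSucc]
            exact hqL ⟨i, rfl⟩
        have hmem : q ∈ closure {w''} := by
          rw [closure_singleton_eq_zeroLocus]
          refine (ProjectiveSpectrum.mem_zeroLocus _ _ _).2 ?_
          change ((ProjectiveSpectrum.asHomogeneousIdeal
            (𝒜 := MvPolynomial.homogeneousSubmodule (Fin (N + 1)) K) w'').toIdeal :
              Set (MvPolynomial (Fin (N + 1)) K)) ⊆ _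
          rw [hw''span]
          intro f hf
          exact Ideal.span_le.2 hqL' hf
        rw [closure_singleton_eq_of_height_eq_zero hht0] at hmem
        exact Set.mem_singleton_iff.1 hmem
      -- `w'` lies in the support of `V₊(ℓ₁) · [line]`, hence on the line and on `V₊(ℓ₁)`
      have hsupp : (ProjSpace.formDivisor ℓ₁ hℓ₁ hℓ₁0).primeInter (X := projectiveSpace N K) iz w' ≠
          0 := by
        rw [hprime, primeCycle_apply_self]
        exact one_ne_zero
      have hzw' : iz ⤳ w' := CartierDivisor.specializes_of_primeInter_ne_zero _ hsupp
      have hℓ₁w' : ℓ₁ ∈ ProjectiveSpectrum.asHomogeneousIdeal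
          (𝒜 := MvPolynomial.homogeneousSubmodule (Fin (N + 1)) K) w' := by
        by_contra h
        exact CartierDivisor.not_avoids_of_primeInter_ne_zero _ hsupp
          ((ProjSpace.formDivisor_avoids_iff hℓ₁ hℓ₁0 zero_lt_one).2 h)
      rw [key w' hzw' hℓ₁w', key ix hizx hℓ₁x]
    -- the two hyperplane sections of `X`: `D₀ = i^*V₊(x_m)`, `D₁ = i^*V₊(ℓ₁)`, `D₀ ∼ D₁`
    set H₀ : CartierDivisor (projectiveSpace N K).left :=
      ProjSpace.formDivisor (MvPolynomial.X m) (X_mem K m) (MvPolynomial.X_ne_zero m) with hH₀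
    set H₁ : CartierDivisor (projectiveSpace N K).left := ProjSpace.formDivisor ℓ₁ hℓ₁ hℓ₁0 with hH₁
    have hH₀η : H₀.Avoids (i.left (genericPoint ↥X.left)) :=
      (ProjSpace.formDivisor_avoids_iff (X_mem K m) _ zero_lt_one).2 hm
    have hηz : i.left (genericPoint ↥X.left) ⤳ iz :=
      i.left.base.hom.map_specializes ((genericPoint_spec ↥X.left).specializes (Set.mem_univ z))
    have hℓ₁η : ℓ₁ ∉ ProjectiveSpectrum.asHomogeneousIdeal
        (𝒜 := MvPolynomial.homogeneousSubmodule (Fin (N + 1)) K) (i.left (genericPoint ↥X.left)) := by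
      intro h
      apply hℓ₁z
      have hmem : iz ∈ closure {i.left (genericPoint ↥X.left)} := hηz.mem_closure
      rw [closure_singleton_eq_zeroLocus] at hmem
      exact (ProjectiveSpectrum.mem_zeroLocus _ _ _).1 hmem h
    have hH₁η : H₁.Avoids (i.left (genericPoint ↥X.left)) :=
      (ProjSpace.formDivisor_avoids_iff hℓ₁ hℓ₁0 zero_lt_one).2 hℓ₁η
    set D₀ : CartierDivisor X.left := H₀.pullbackAvoiding i.left hH₀η with hD₀
    set D₁ : CartierDivisor X.left := H₁.pullbackAvoiding i.left hH₁η with hD₁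
    have hlin : D₀.LinEquiv D₁ :=
      ((ProjSpace.hyperplane_linEquiv_formDivisor (X_mem K m) (MvPolynomial.X_ne_zero m)).symm.trans
        (ProjSpace.hyperplane_linEquiv_formDivisor hℓ₁ hℓ₁0)).pullbackAvoiding i.left hH₀η hH₁η
    -- `D₀ · [line] - D₁ · [line] ∈ Rat₀(X)`
    have hcd : primeCycle z ∈ cyclesOfDim X.left (0 + 1) := hz.primeCycle_mem
    have hfin : (Function.support (primeCycle z)).Finite := finite_support_of_compactSpace _
    have hdiff := ratTrivialOn_le_ratTrivial (hlin.interCycle_sub_interCycle_mem hcd hfin)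
    rw [CartierDivisor.interCycle_primeCycle, CartierDivisor.interCycle_primeCycle] at hdiff
    -- `D₁ · [line] = [x]`
    have hH₁z : H₁.Avoids iz := (ProjSpace.formDivisor_avoids_iff hℓ₁ hℓ₁0 zero_lt_one).2 hℓ₁z
    have hmap := CartierDivisor.map_primeInter_pullbackAvoiding i
      (ProjSpace.isEffective_formDivisor hℓ₁ hℓ₁0) hH₁η hH₁z
    have hD₁x : D₁.primeInter z = primeCycle x := by
      ext x'
      have h1 := congrFun (congrArg DFunLike.coe hmap) (i.left.base x')
      rw [algebraicCycleMap_apply_base_of_isClosedImmersion] at h1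
      rw [h1, hprime, hw'x]
      by_cases hx' : x' = x
      · subst hx'
        rw [primeCycle_apply_self, primeCycle_apply_self]
      · rw [primeCycle_apply_of_ne hx', primeCycle_apply_of_ne]
        exact fun h => hx' (i.left.isClosedEmbedding.injective h)
    rw [hD₁x] at hdiff
    -- `c' = D₀ · [line]`, supported on `W`
    have hz1 : height z = (0 : ℕ) + 1 := by
      rw [hz.height_eq_one]
      norm_num
    refine ⟨D₀.primeInter z, D₀.primeInter_mem_cyclesOfDim hz1, fun x' hx' => ?_, ?_⟩
    · have h1 : ¬ D₀.Avoids x' := D₀.not_avoids_of_primeInter_ne_zero hx'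
      have h2 : ¬ H₀.Avoids (i.left x') := fun h =>
        h1 (CartierDivisor.Avoids.pullbackAvoiding_of_base i.left hH₀η h)
      by_contra h3
      exact h2 ((ProjSpace.formDivisor_avoids_iff (X_mem K m) (MvPolynomial.X_ne_zero m)
        zero_lt_one).2 h3)
    · change primeCycle x - D₀.primeInter z ∈ ratTrivial X.left 0
      rw [← neg_sub]
      exact neg_mem hdiff

end ChowZero

end Literature.AlgebraicGeometry.Motives

end
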